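import Summits.QuantumFields.YangMills.Theorems.BalabanLadderIRTwistedSlabExpLine
import HarnessLib

/-!
# The REAL forms: `su(N)`-valued site fields, the real Coulomb slice at a configuration, and the coercivity ∕ positivity of the Hessian of the T1
# exponent on it (the tangent model `V` of the slice chart M1b, as real subspaces of the exponential chart)

HELPER toward stub **T1** `TwistedSlabAnchor` (LINE `twisted-slab-continuity`, crux `IRcof` stmt-QuantumFields-26930, census row 43;
LEAD prover ym-ir-line-tsc-p1 g3; `--supports` the crux, `--as helper`).  Sequel of K10 (`…TwistedSlabExpLine`) and K5 (`…ExpChartTaylor`).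
* §1 `suFields` — the `ℝ`-submodule of skew-Hermitian traceless site fields (`𝔰𝔲(N)`-valued 0-forms); `covDeriv_mem_suFields`, `covDerivAdj_mem_suFields`
  (the covariant differences of `…CovariantCalculus` preserve it at a unitary background); `covDiv_add`, `covDiv_smul` (the divergence is `ℝ`-linear).
* §2 `realCoulombSlice U` — the `ℝ`-submodule of `su(N)`-valued lattice 1-forms `a` with `div_U a = 0` (the Coulomb ∕ background-Lorenz slice through `U`,
  the tangent model `V` of the tubular coordinates); membership lemmas.
* §3 ★★ `twistedExponent_hessian_gap_of_mem_realCoulombSlice`: at every zero `U` of `twistedExponent k` (`SU(N)`, `k` a unit) and every `a ∈ realCoulombSlice U`: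
  `4 sin²(π/(N(m+1))) · Σ_x Σ_μ S(a_μ x) ≤ d²/dt²|₀ twistedExponent k (e^{ta}·U)` (K10 read on the slice); ★ `hessian_pos_of_mem_realCoulombSlice_ne_zero`: the line
  Hessian is STRICTLY POSITIVE for `a ≠ 0` in the slice (the `hpos` input of lit-4's `peano_two_of_contDiffAt_of_isLocalMin` ∕ `tendsto_laplaceMethod_*`),
  uniformly bounded below by `4 sin²(π/(N(m+1)))·‖a‖²` in the chart norm (`…_norm`).
NOT here (honest scope): the real version of K11's linear equivalence (gauge modes ⊕ real slice), the log chart, IFT, Haar densities, `hchart` (M1b proper);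
M3; M4; T1-box 0∕1, T1 proper 0∕1.

HONEST FRAMING: linear algebra ∕ bookkeeping on one box; nothing here bears on `IRcof`, `IR`, or the Yang–Mills mass gap (Clay: NOT proved); R4 =
`BalabanLadder.UV` only.  References: M. García Pérez, A. González-Arroyo, M. Okawa, JHEP 10 (2017) 150 §2.3, §2.5; I. Montvay, G. Münster, *Quantum Fields
on a Lattice* §3.2.5.
-/

set_option autoImplicit false

noncomputable section

open scoped Matrix Matrix.Norms.Frobenius
open Finset NormedSpace
open Literature.MathematicalPhysics.QuantumFieldTheory Literature.MathematicalPhysics.QuantumLattice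

namespace Summit.QuantumFields.YangMills.Cruxes.IRcof.TwistedSlab

variable {N : ℕ} {n₀ n₁ n₂ n₃ : ℕ}

/-! ## §1 `su(N)`-valued site fields -/

section SuFields

variable (N n₀ n₁ n₂ n₃) in
/-- **The real subspace of `su(N)`-valued site fields**: skew-Hermitian and traceless at every site. [folklore] -/
def suFields : Submodule ℝ (FinTorusSite n₀ n₁ n₂ n₃ → Matrix (Fin N) (Fin N) ℂ) where
  carrier := {Φ | ∀ x, (Φ x)ᴴ = -Φ x ∧ (Φ x).trace = 0}
  add_mem' := by
    intro a b ha hb x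
    simp only [Set.mem_setOf_eq] at ha hb
    refine ⟨?_, ?_⟩
    · rw [Pi.add_apply, Matrix.conjTranspose_add, (ha x).1, (hb x).1, neg_add]
    · rw [Pi.add_apply, Matrix.trace_add, (ha x).2, (hb x).2, add_zero]
  zero_mem' := by intro x; simp
  smul_mem' := by
    intro c a ha x
    simp only [Set.mem_setOf_eq] at ha
    refine ⟨?_, ?_⟩
    · rw [Pi.smul_apply, Matrix.conjTranspose_smul, star_trivial, (ha x).1, smul_neg]
    · rw [Pi.smul_apply, Matrix.trace_smul, (ha x).2, smul_zero]

/-- Membership in `suFields`. [folklore] -/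
theorem mem_suFields {Φ : FinTorusSite n₀ n₁ n₂ n₃ → Matrix (Fin N) (Fin N) ℂ} :
    Φ ∈ suFields N n₀ n₁ n₂ n₃ ↔ ∀ x, (Φ x)ᴴ = -Φ x ∧ (Φ x).trace = 0 := Iff.rfl

variable {U : FinTorusSite n₀ n₁ n₂ n₃ × Fin 4 → Matrix (Fin N) (Fin N) ℂ}

/-- Conjugation by the background preserves skew-Hermitian-ness. [folklore] -/
theorem conjTranspose_covShift {Φ : FinTorusSite n₀ n₁ n₂ n₃ → Matrix (Fin N) (Fin N) ℂ} (hΦ : ∀ x, (Φ x)ᴴ = -Φ x) (μ : Fin 4)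
    (x : FinTorusSite n₀ n₁ n₂ n₃) : (covShift U μ Φ x)ᴴ = -covShift U μ Φ x := by
  rw [covShift_apply, Matrix.conjTranspose_mul, Matrix.conjTranspose_mul, Matrix.conjTranspose_conjTranspose, hΦ, Matrix.neg_mul, Matrix.mul_neg,
    Matrix.mul_assoc]

/-- `∇⁺_μ` preserves `suFields` at a unitary background. [folklore] -/
theorem covDeriv_mem_suFields (hU : ∀ e, U e ∈ Matrix.unitaryGroup (Fin N) ℂ) (μ : Fin 4) {Φ : FinTorusSite n₀ n₁ n₂ n₃ → Matrix (Fin N) (Fin N) ℂ}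
    (hΦ : Φ ∈ suFields N n₀ n₁ n₂ n₃) : covDeriv U μ Φ ∈ suFields N n₀ n₁ n₂ n₃ := by
  intro x
  refine ⟨?_, ?_⟩
  · rw [covDeriv_apply, ← covShift_apply, Matrix.conjTranspose_sub, conjTranspose_covShift (fun y => (hΦ y).1), (hΦ x).1]
    abel
  · rw [covDeriv_apply, ← covShift_apply, Matrix.trace_sub, trace_covShift hU, (hΦ _).2, (hΦ x).2, sub_self]

/-- `S_μ† − 1` preserves `suFields` at a unitary background. [folklore] -/
theorem covDerivAdj_mem_suFields (hU : ∀ e, U e ∈ Matrix.unitaryGroup (Fin N) ℂ) (μ : Fin 4) {Ψ : FinTorusSite n₀ n₁ n₂ n₃ → Matrix (Fin N) (Fin N) ℂ}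
    (hΨ : Ψ ∈ suFields N n₀ n₁ n₂ n₃) : (fun x => covShiftAdj U μ Ψ x - Ψ x) ∈ suFields N n₀ n₁ n₂ n₃ := by
  intro x
  have h2 : U (siteUnshift x μ, μ) * (U (siteUnshift x μ, μ))ᴴ = 1 := (hU _).2
  refine ⟨?_, ?_⟩
  · simp only [covShiftAdj, Matrix.conjTranspose_sub, Matrix.conjTranspose_mul, Matrix.conjTranspose_conjTranspose, (hΨ _).1, Matrix.mul_neg,
      Matrix.neg_mul, Matrix.mul_assoc]
    abel
  · simp only [covShiftAdj, Matrix.trace_sub]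
    rw [Matrix.trace_mul_cycle, h2, Matrix.one_mul, (hΨ _).2, (hΨ x).2, sub_self]

/-- The covariant divergence is additive. [folklore] -/
theorem covDiv_add (a b : Fin 4 → FinTorusSite n₀ n₁ n₂ n₃ → Matrix (Fin N) (Fin N) ℂ) (x : FinTorusSite n₀ n₁ n₂ n₃) :
    covDiv U (a + b) x = covDiv U a x + covDiv U b x := by
  simp only [covDiv, covShiftAdj, Pi.add_apply, Matrix.mul_add, Matrix.add_mul, ← Finset.sum_add_distrib]
  exact Finset.sum_congr rfl fun μ _ => by abel

/-- The covariant divergence is real-homogeneous. [folklore] -/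
theorem covDiv_smul (c : ℝ) (a : Fin 4 → FinTorusSite n₀ n₁ n₂ n₃ → Matrix (Fin N) (Fin N) ℂ) (x : FinTorusSite n₀ n₁ n₂ n₃) :
    covDiv U (c • a) x = c • covDiv U a x := by
  simp only [covDiv, covShiftAdj, Pi.smul_apply, Matrix.mul_smul, Matrix.smul_mul, Finset.smul_sum, smul_sub]

end SuFields

/-! ## §2 The real Coulomb slice through a configuration -/

section Slice

variable (U : FinTorusSite n₀ n₁ n₂ n₃ × Fin 4 → Matrix (Fin N) (Fin N) ℂ)

/-- **The real Coulomb slice at `U`**: `su(N)`-valued lattice 1-forms `a` (one `suFields` per direction) with vanishing background covariant divergence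
`div_U a = 0` — the tangent model `V` of the tubular coordinates around the gauge orbit of `U`. [cite: GarciaperezGonzalezarroyoOkawa2017, §2.5]
[cite: MontvayMunster1994, §3.2.5] -/
def realCoulombSlice : Submodule ℝ (Fin 4 → FinTorusSite n₀ n₁ n₂ n₃ → Matrix (Fin N) (Fin N) ℂ) where
  carrier := {a | (∀ μ, a μ ∈ suFields N n₀ n₁ n₂ n₃) ∧ ∀ x, covDiv U a x = 0}
  add_mem' := by
    intro a b ha hb
    refine ⟨fun μ => (suFields N n₀ n₁ n₂ n₃).add_mem (ha.1 μ) (hb.1 μ), fun x => ?_⟩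
    rw [covDiv_add, ha.2 x, hb.2 x, add_zero]
  zero_mem' := ⟨fun μ => (suFields N n₀ n₁ n₂ n₃).zero_mem, fun x => by simp [covDiv, covShiftAdj]⟩
  smul_mem' := by
    intro c a ha
    refine ⟨fun μ => (suFields N n₀ n₁ n₂ n₃).smul_mem c (ha.1 μ), fun x => ?_⟩
    rw [covDiv_smul, ha.2 x, smul_zero]

variable {U}

/-- Membership in the real Coulomb slice. [folklore] -/
theorem mem_realCoulombSlice {a : Fin 4 → FinTorusSite n₀ n₁ n₂ n₃ → Matrix (Fin N) (Fin N) ℂ} :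
    a ∈ realCoulombSlice U ↔ (∀ μ x, (a μ x)ᴴ = -a μ x ∧ (a μ x).trace = 0) ∧ ∀ x, covDiv U a x = 0 := Iff.rfl

/-- Skewness of slice elements. [folklore] -/
theorem skew_of_mem_realCoulombSlice {a : Fin 4 → FinTorusSite n₀ n₁ n₂ n₃ → Matrix (Fin N) (Fin N) ℂ} (ha : a ∈ realCoulombSlice U) (μ : Fin 4)
    (x : FinTorusSite n₀ n₁ n₂ n₃) : (a μ x)ᴴ = -a μ x := (ha.1 μ x).1

/-- Tracelessness of slice elements. [folklore] -/
theorem trace_of_mem_realCoulombSlice {a : Fin 4 → FinTorusSite n₀ n₁ n₂ n₃ → Matrix (Fin N) (Fin N) ℂ} (ha : a ∈ realCoulombSlice U) (μ : Fin 4)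
    (x : FinTorusSite n₀ n₁ n₂ n₃) : (a μ x).trace = 0 := (ha.1 μ x).2

/-- The Coulomb condition of slice elements. [folklore] -/
theorem covDiv_of_mem_realCoulombSlice {a : Fin 4 → FinTorusSite n₀ n₁ n₂ n₃ → Matrix (Fin N) (Fin N) ℂ} (ha : a ∈ realCoulombSlice U)
    (x : FinTorusSite n₀ n₁ n₂ n₃) : covDiv U a x = 0 := ha.2 x

end Slice

/-! ## §3 Coercivity and strict positivity of the Hessian on the real Coulomb slice at a classical vacuum -/

section Coercive

variable [NeZero N] {m m₂ m₃ : ℕ}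

/-- ★★ **K10 read on the slice**: at every zero `U` of `twistedExponent k` (`SU(N)`, `k` a unit, box `(m+1)² × (m₂+1) × (m₃+1)`) and every
`a ∈ realCoulombSlice ↑U`: `4 sin²(π/(N(m+1))) · Σ_x Σ_μ S(a_μ x) ≤ d²/dt²|₀ twistedExponent k (e^{ta}·U)`, uniformly in the long extents.
[cite: GarciaperezGonzalezarroyoOkawa2017, §2.2, §2.5] -/
theorem twistedExponent_hessian_gap_of_mem_realCoulombSlice {k : ZMod N} (hk : IsUnit k)
    (U : FinTorusSite (m + 1) (m + 1) (m₂ + 1) (m₃ + 1) × Fin 4 → Matrix.specialUnitaryGroup (Fin N) ℂ) (hU : twistedExponent k U = 0)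
    {a : Fin 4 → FinTorusSite (m + 1) (m + 1) (m₂ + 1) (m₃ + 1) → Matrix (Fin N) (Fin N) ℂ}
    (ha : a ∈ realCoulombSlice (fun e => ((U e : Matrix.specialUnitaryGroup (Fin N) ℂ) : Matrix (Fin N) (Fin N) ℂ))) :
    4 * Real.sin (Real.pi / ((N : ℝ) * (m + 1 : ℕ))) ^ 2 * ∑ x, ∑ μ, (((a μ x)ᴴ * a μ x).trace).re ≤
      iteratedDeriv 2 (fun t => twistedExponent k (expLine U (skew_of_mem_realCoulombSlice ha) (trace_of_mem_realCoulombSlice ha) t)) 0 :=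
  twistedExponent_hessian_gap_expLine hk U hU (skew_of_mem_realCoulombSlice ha) (trace_of_mem_realCoulombSlice ha) (covDiv_of_mem_realCoulombSlice ha)

omit [NeZero N] in
/-- The Hilbert–Schmidt mass of a non-zero 1-form is positive. [folklore] -/
theorem sum_hsS_pos_of_ne_zero {a : Fin 4 → FinTorusSite n₀ n₁ n₂ n₃ → Matrix (Fin N) (Fin N) ℂ} (ha : a ≠ 0) :
    0 < ∑ x, ∑ μ, (((a μ x)ᴴ * a μ x).trace).re := by
  by_contra hle
  push Not at hle
  have hnn : ∀ x, 0 ≤ ∑ μ, (((a μ x)ᴴ * a μ x).trace).re := fun x => Finset.sum_nonneg fun μ _ => re_trace_conjTranspose_mul_self_nonneg _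
  have hzero : ∑ x, ∑ μ, (((a μ x)ᴴ * a μ x).trace).re = 0 := le_antisymm hle (Finset.sum_nonneg fun x _ => hnn x)
  apply ha
  funext μ x
  have hx := (Finset.sum_eq_zero_iff_of_nonneg fun y _ => hnn y).1 hzero x (Finset.mem_univ _)
  have hμ := (Finset.sum_eq_zero_iff_of_nonneg fun ν _ => re_trace_conjTranspose_mul_self_nonneg (a ν x)).1 hx μ (Finset.mem_univ _)
  exact eq_zero_of_hsS_eq_zero hμ

/-- ★ **Strict positivity of the Hessian on the real Coulomb slice** (the `hpos` input of the Laplace-method theorems): for `N(m+1) ≥ 2`, at a zero `U` of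
`twistedExponent k` and `a ∈ realCoulombSlice ↑U`, `a ≠ 0`: `0 < d²/dt²|₀ twistedExponent k (e^{ta}·U)`. [cite: Breitung1994, Thm 41 (positive definite Hessian)]
[cite: GarciaperezGonzalezarroyoOkawa2017, §2.2] -/
theorem hessian_pos_of_mem_realCoulombSlice_ne_zero {k : ZMod N} (hk : IsUnit k) (hNm : 2 ≤ N * (m + 1))
    (U : FinTorusSite (m + 1) (m + 1) (m₂ + 1) (m₃ + 1) × Fin 4 → Matrix.specialUnitaryGroup (Fin N) ℂ) (hU : twistedExponent k U = 0)
    {a : Fin 4 → FinTorusSite (m + 1) (m + 1) (m₂ + 1) (m₃ + 1) → Matrix (Fin N) (Fin N) ℂ}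
    (ha : a ∈ realCoulombSlice (fun e => ((U e : Matrix.specialUnitaryGroup (Fin N) ℂ) : Matrix (Fin N) (Fin N) ℂ))) (ha0 : a ≠ 0) :
    0 < iteratedDeriv 2 (fun t => twistedExponent k (expLine U (skew_of_mem_realCoulombSlice ha) (trace_of_mem_realCoulombSlice ha) t)) 0 := by
  have hsin : 0 < Real.sin (Real.pi / ((N : ℝ) * (m + 1 : ℕ))) := by
    have hd : (1 : ℝ) < (N : ℝ) * (m + 1 : ℕ) := by exact_mod_cast hNm
    refine Real.sin_pos_of_pos_of_lt_pi (div_pos Real.pi_pos (by linarith)) ?_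
    rw [div_lt_iff₀ (by linarith)]
    nlinarith [Real.pi_pos]
  have h := twistedExponent_hessian_gap_of_mem_realCoulombSlice hk U hU ha
  have hmass := sum_hsS_pos_of_ne_zero ha0
  have : 0 < 4 * Real.sin (Real.pi / ((N : ℝ) * (m + 1 : ℕ))) ^ 2 * ∑ x, ∑ μ, (((a μ x)ᴴ * a μ x).trace).re := by positivity
  linarith

/-- ★ **Coercivity in the chart norm on the real Coulomb slice**: `4 sin²(π/(N(m+1))) · ‖a‖² ≤ d²/dt²|₀ twistedExponent k (e^{ta}·U)` (sup-over-links Frobenius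
norm; K5 `norm_sq_le_sum_hsS`). [cite: Breitung1994, Thm 41] [cite: GarciaperezGonzalezarroyoOkawa2017, §2.2] -/
theorem twistedExponent_hessian_gap_norm_of_mem_realCoulombSlice {k : ZMod N} (hk : IsUnit k)
    (U : FinTorusSite (m + 1) (m + 1) (m₂ + 1) (m₃ + 1) × Fin 4 → Matrix.specialUnitaryGroup (Fin N) ℂ) (hU : twistedExponent k U = 0)
    {a : Fin 4 → FinTorusSite (m + 1) (m + 1) (m₂ + 1) (m₃ + 1) → Matrix (Fin N) (Fin N) ℂ}
    (ha : a ∈ realCoulombSlice (fun e => ((U e : Matrix.specialUnitaryGroup (Fin N) ℂ) : Matrix (Fin N) (Fin N) ℂ))) :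
    4 * Real.sin (Real.pi / ((N : ℝ) * (m + 1 : ℕ))) ^ 2 * ‖a‖ ^ 2 ≤
      iteratedDeriv 2 (fun t => twistedExponent k (expLine U (skew_of_mem_realCoulombSlice ha) (trace_of_mem_realCoulombSlice ha) t)) 0 :=
  le_trans (mul_le_mul_of_nonneg_left (norm_sq_le_sum_hsS a) (by positivity)) (twistedExponent_hessian_gap_of_mem_realCoulombSlice hk U hU ha)

end Coercive

end Summit.QuantumFields.YangMills.Cruxes.IRcof.TwistedSlab

end
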